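/-
Copyright: rh-split cell (screw, bridge) gen 19, 2026-08-28.  Splitting search over kernel-typed
RH-equivalences.  A splitting `A ∧ B ⟹ RH` is CONDITIONAL bookkeeping unless `A` and `B` are both
proved; nothing here bears on the truth of RH.
-/
import Summits.RiemannHypothesis.RiemannHypothesis.Theorems.Splittings.SlidingTheftGerm

/-!
# «SLIDING THEFT GERM» — optional add-on: the no-go FIRES on a genuine off-line tower

§13 (rh-splitx-theory-1's request 03:45:40Z, inhabited antecedent): `towerConfig` = one atom of weight 1 at
`κ = 1/4 + i(n+1)` for every `n : ℕ`; `germHyp_towerConfig : GermHyp (1/4) towerConfig`;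
`superlogTower_towerConfig` (below `Y` it has `⌊Y⌋ − 2 > Y/2 ≥ |C| log Y` atoms, via `log = o(id)`); hence
`not_boundedSlidingTheft_towerConfig`: NO bounded sliding theft (any `U > 0`, `η̄ ≤ 1/2`, `A`) reproduces this
tower's prime-window function — the law acts on an inhabited configuration, not only on the empty one of §12.

HONEST LABEL: elementary; an INSTRUMENT example; ζ-free, RH-free; toward RH: 0.  Nothing here bears on the truth of RH.
-/

set_option linter.dupNamespace false

namespace Summit.RiemannHypothesis.RiemannHypothesis.Theorems.Splittings.SlidingGerm

open Summit.RiemannHypothesis.RiemannHypothesis.Theorems.Splittings.ScrewLatticeTower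

/-! ## 13. The no-go fires on a genuine off-line tower (inhabited antecedent; theory-1's request) -/

/-- A GENUINE off-line tower: one atom of weight `1` at `κ = 1/4 + i(n+1)` for every `n : ℕ` (second family =
first, weight `0`).  Unresolved weight below `Y` is `≍ Y`, super-logarithmic. -/
@[reducible] noncomputable def towerConfig : Config :=
  ⟨ℕ, fun _ ↦ 1, fun _ ↦ 0, fun n ↦ ⟨1 / 4, n + 1⟩, fun n ↦ ⟨1 / 4, n + 1⟩⟩

/-- The tower configuration satisfies the standing hypotheses with `σ* = 1/4`. -/
theorem germHyp_towerConfig : GermHyp (1 / 4) towerConfig where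
  m_nonneg := fun _ ↦ by simp
  re_mem := fun _ ↦ by simp
  σs_le := by norm_num
  one_le_im := fun n ↦ by
    have hn : (0 : ℝ) ≤ ((n : ℕ) : ℝ) := Nat.cast_nonneg _
    constructor <;> linarith
  summable := by
    have h : Summable fun n : ℕ ↦ (1 : ℝ) / ((n + 1 : ℕ) : ℝ) ^ 2 :=
      (summable_nat_add_iff 1).mpr (Real.summable_one_div_nat_pow.mpr one_lt_two)
    refine h.congr fun n ↦ ?_
    simp only [zero_div, add_zero]
    push_cast
    rfl

/-- The tower configuration is a super-logarithmic tower: below `Y ≥ 7` it has `⌊Y⌋ − 2 > Y/2 ≥ |C| log Y`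
atoms of weight `1` (for `Y` large, by `log = o(id)`). -/
theorem superlogTower_towerConfig : SuperlogTower towerConfig := by
  intro C Y₀
  have h1 : ∀ᶠ Y : ℝ in Filter.atTop, |C| * Real.log Y ≤ Y / 2 := by
    have hb := Real.isLittleO_log_id_atTop.bound (show (0 : ℝ) < 1 / (2 * (|C| + 1)) by positivity)
    filter_upwards [hb, Filter.eventually_ge_atTop (1 : ℝ)] with Y hY hY1
    rw [Real.norm_eq_abs, Real.norm_eq_abs, abs_of_nonneg (Real.log_nonneg hY1), id,
      abs_of_nonneg (by linarith : (0 : ℝ) ≤ Y)] at hY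
    have hC0 : 0 ≤ |C| := abs_nonneg C
    have h2 : |C| * Real.log Y ≤ |C| * (1 / (2 * (|C| + 1)) * Y) := mul_le_mul_of_nonneg_left hY hC0
    have h3 : |C| * (1 / (2 * (|C| + 1)) * Y) ≤ Y / 2 := by
      rw [show |C| * (1 / (2 * (|C| + 1)) * Y) = Y / 2 * (|C| / (|C| + 1)) by field_simp]
      have : |C| / (|C| + 1) ≤ 1 := by rw [div_le_one (by positivity)]; linarith
      have hY0 : 0 ≤ Y / 2 := by linarith
      nlinarith
    linarith
  obtain ⟨Y, hYC, hY0, hY7⟩ :=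
    (h1.and ((Filter.eventually_ge_atTop Y₀).and (Filter.eventually_ge_atTop (7 : ℝ)))).exists
  have hfl : Y < (⌊Y⌋₊ : ℝ) + 1 := Nat.lt_floor_add_one Y
  have hfl2 : 2 ≤ ⌊Y⌋₊ := Nat.le_floor (by push_cast; linarith)
  have hcast : (((⌊Y⌋₊ - 2 : ℕ) : ℝ)) = (⌊Y⌋₊ : ℝ) - 2 := by push_cast [Nat.cast_sub hfl2]; ring
  refine ⟨Y, hY0, Finset.range (⌊Y⌋₊ - 2), fun n hn ↦ ?_, ?_⟩
  · have hn' : n < ⌊Y⌋₊ - 2 := Finset.mem_range.mp hn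
    have hn3 : n + 3 ≤ ⌊Y⌋₊ := Nat.lt_sub_iff_add_lt.mp hn'
    have hn3' : (n : ℝ) + 3 ≤ Y := by
      have := Nat.floor_le (show (0 : ℝ) ≤ Y by linarith)
      exact_mod_cast (show ((n + 3 : ℕ) : ℝ) ≤ (⌊Y⌋₊ : ℝ) by exact_mod_cast hn3).trans this
    have hn0 : (0 : ℝ) ≤ ((n : ℕ) : ℝ) := Nat.cast_nonneg _
    calc ‖towerConfig.κ₁ n‖ ≤ |(towerConfig.κ₁ n).re| + |(towerConfig.κ₁ n).im| :=
          Complex.norm_le_abs_re_add_abs_im _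
      _ = 1 / 4 + ((n : ℝ) + 1) := by
          rw [abs_of_nonneg (by norm_num), abs_of_nonneg (by linarith)]
      _ ≤ Y := by linarith
  · simp only [towerConfig, Finset.sum_const, Finset.card_range, nsmul_eq_mul, mul_one, hcast]
    have : C * Real.log Y ≤ |C| * Real.log Y :=
      mul_le_mul_of_nonneg_right (le_abs_self C) (Real.log_nonneg (by linarith))
    linarith

/-- **THE NO-GO FIRES**: the genuine tower `towerConfig` admits NO bounded sliding theft (any window `U > 0`,
any slide bound `η̄ ≤ 1/2`, any counting constant `A`) — the law is seen to act on an inhabited off-line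
configuration, not only to spare the empty one (§12). -/
theorem not_boundedSlidingTheft_towerConfig {U ηbar A : ℝ} (hU : 0 < U) (hηbar : ηbar ≤ 1 / 2) :
    ¬ BoundedSlidingTheft U ηbar A towerConfig :=
  not_boundedSlidingTheft_of_superlogTower germHyp_towerConfig hU hηbar superlogTower_towerConfig

end Summit.RiemannHypothesis.RiemannHypothesis.Theorems.Splittings.SlidingGerm
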